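import Mathlib
import HarnessLib
import HarnessLib.Audit
import Summits.AnomalousDissipation.Statement
import Summits.AnomalousDissipation.AnomalousDissipation.Theorems.SteadyWeakLimitSteadyToSummit
import HarnessLib.Audit.Status.Attr

/-!
Route: DyadicWallCascade

DORMANT since 2026-08-24T13:48:08Z (reconciler: no traction for 6.8 d (last activity item-evidence-added at 2026-08-17T17:51:17Z); parked, not closed — `ledger route dormant route-AnomalousDissipation-DyadicWallCascade --off` to reactiv) — unstaffed, not closed; items shared with open routes are served there. `ledger route dormant <id> --off` reactivates.

# Route DyadicWallCascade — one ν-free viscous wall profile feeds the whole dyadic viscosity ladder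

It suffices to show X = X₂ ∧ X₃ ∧ X₄ (lens profile-and-certify, cycle 2; no card — novel-route; rev
2 = route-repair after the
analytic-rigidity refutation of the rev-1 profile object). X₂ HalfSpaceHierarchy (the PROFILE,
ν-free, Euler level): a bounded steady
Euler flow V on the open upper half-space, 1-periodic in x, y on the band 1 ≤ z ≤ 2 and invariant
under the dilation X ↦ 2X (discrete
self-similarity of degree 0 towards the plane z = 0), with zero mass flux and NON-ZERO energy flux F
through {z = 1} — an exact
period-doubling cascade attached to a plane, carrying the constant flux F to the wall. X₃
ViscousContinuation (ν-free, Navier–Stokes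
level): such a hierarchy continues to the wall as ONE bounded smooth mirror-symmetric force-free
steady Navier–Stokes flow W at ν = 1 on
ℝ³ with bounded pressure P whose dyadic blow-downs (W, P)(2^m·) converge to (V, Q) uniformly on the
band — equivalently (W, P) → (V, Q)
uniformly as z → +∞ (free-standing decl ViscousWallProfile). W has NO exact horizontal period
anywhere: a real-analytic entire flow that
is periodic on an open set is periodic at every height and blows down to a horizontally constant
field with F = 0 (landed negative
lemma WallProfileExists_false_of_SteadyNSRealAnalytic against the rev-1 object WallProfileExists,
which stays in the file HELD as the
settled negative edge); the dyadic horizontal structure is carried by V alone and W inherits it only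
asymptotically. X₄
DyadicRealisation: a viscous wall profile glues into a smoothly, steadily forced periodic box along
ν_m = 2^(-m): in inner units the
box state is a 2^m-periodic force-free approximant U_m of the aperiodic W below height ~2^(m−2)
(u_m(x) = U_m(x/ν_m) ≈ W(x/ν_m); W
itself lives on ℝ³ only), matched through V to an outer conveyor flow driven by one smooth f —
giving loud light steady states: the
steady zeroth law (verbatim CoherentStates.SteadyZerothLaw, stmt-0219), which the PROVED
SteadyToSummit (stmt-1311) turns into the
Statement.
Lean: `HalfSpaceHierarchy ∧ ViscousContinuation ∧ DyadicRealisation`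

## Assembly
Pure logic plus ONE landed theorem (glue.lean, certified natively): h₃ h₂ : the viscous-wall-profile
block (verbatim
ViscousWallProfile), h₄ (h₃ h₂) : the steady zeroth law (the antecedent of
SteadyWeakLimit.SteadyToSummit, stmt-1311, verbatim
CoherentStates.SteadyZerothLaw stmt-0219), and `Theorems.steadyToSummit_proof` (imported:
Theorems/SteadyWeakLimitSteadyToSummit.lean)
returns AnomalousDissipation. All three cruxes are load-bearing; the two support decls
(ViscousWallProfile, and the held rev-1
WallProfileExists) are not hypotheses.

Rationale: WHY THIS LINE. The Statement asks for a SEQUENCE ν_j → 0 at fixed f; exact ν-self-similarity on T³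
is impossible (u ↦ A u(N·) rescales the force),
but it survives in an inner region that is force-free: a steady Euler flow invariant under X ↦ 2X
about a symmetry plane, capped by a
viscous profile W with u_ν(x) ≈ W(x/ν) there (equality only in the limit ν = 2^(-m) → 0: W is
horizontally aperiodic, see below), is the
SAME object at every rung 2^(-m), and its dissipation ∫⟨|∇W|²⟩dZ = 2|F| per unit wall area is
exactly ν-independent. Dissipation then
lives, in the limit, on the plane: the (h, D) = (0, 2) corner of the multifractal spectrum — the one
cascade geometry with local Reynolds
number O(1) at the cut-off with O(1) velocity, hence describable by a finite profile — which is
exactly the equality case of De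
Rosa–Drivas–Inversi (arXiv:2301.09603 Thm 1.2: dissipation ≪ H^d space–time; sharpness realised so
far only at a time instant, op. cit.
p.5) and must be non-BV at the plane (De Rosa–Inversi, in tree). Bernoulli's theorem forces the
structure (NOTES L4 of the opener):
through-flowing fluid is asymptotically irrotational, descending and ascending channels stay
disconnected with a head difference ΔH, the
separating vortex sheaths wrap 4-way branching jets and are stretched ×2 per level because channel
perimeter doubles — 3-D vortex
stretching is what makes the hierarchy kinematically exact (the 2-D analogue is provably empty,
NOTES L3). REV 2 (route-repair
2026-08-17, after refuter rattack-18630): real-analyticity of smooth entire steady Navier–Stokes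
flows (Morrey 1958 / Kahane 1969, fact
Literature.Uncategorized.SteadyNSRealAnalytic) forbids ANY exact horizontal period of W on an open
set — the identity principle spreads
it to every height, the blow-down inherits all periods 2^(-k) and is horizontally constant, so F = 0
(landed:
Theorems/DyadicRealisation/Negative/WallProfileExistsFalseOfSteadyNSRealAnalytic.lean, killing the
rev-1 object WallProfileExists, which
asked period 1 on |z| ≤ 1 and 2^j on the dyadic bands); independently, the energy flux J(Z) =
⟨W₃(|W|²/2 + P)⟩ − ∂_Z⟨|W|²/2⟩ of a
bounded mirror-symmetric force-free profile is odd, non-increasing (dJ/dZ = −⟨|∇W|²⟩) and bounded,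
so a globally bi-periodic one has
∫|∇W|² < ∞ per cell, ∇W → 0 at z = ±∞, J(±∞) = 0, J ≡ 0: it is constant. The profile is therefore
APERIODIC by necessity: at height
Z it carries the flux F through eddies of size ~Z with |∇W| ~ 1/Z (dissipation density ~Z^(-2),
integrable), which no fixed cell can
do; the dyadic structure is V's, inherited by W only asymptotically ((W, P) − (V, Q) → 0 uniformly
as z → +∞), and near the cap W is
at best limit-periodic per height slab. Forced normalisations of the repaired object: F < 0 (inflow
from infinity: J(0) = 0 ≥ J(+∞) =
F), zero Reynolds stress ⟨V₃V_h⟩ = 0 of the blow-down (else ⟨W_h⟩ grows linearly; the 4-fold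
symmetric design gives it), dissipation
2|F| per unit wall area. Imported: two-phase Bernoulli free boundaries (Alt–Caffarelli–Friedman
doi:10.1090/s0002-9947-1984-0732100-6,
jets with two fluids doi:10.1512/iumj.1984.33.33011) for the sheet skeleton; spatial dynamics /
exponential dichotomies (Kirchgässner
doi:10.1016/0022-0396(82)90058-4) on the scale axis s = log₂(1/z) where V is a fixed point with
viscosity as its one relevant direction
(the Lanford/Choptuik shape of "profile + certified linearisation", doi:10.12942/lrr-2007-5;
discretely self-similar NS profiles exist in
the forward setting, Bradshaw–Tsai doi:10.1007/s00023-016-0519-0). No listed route posits a ν-free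
wall profile: FrozenK41 builds the
opposite corner (h = 1/3, Burgers skeletons, holding forces growing with depth), BoussinesqOctaves
INDUCTS on the ladder, LandauJetArena
zooms continuously at a point source.

RANKED CRUXES. #2 HalfSpaceHierarchy (crux, unchanged) — there is a bounded steady Euler flow (V, Q)
on the open upper half-space, smooth there, divergence free, 1-periodic in x and y on the band 1 ≤ z
≤ 2, invariant under X ↦ 2X (V and Q of degree 0), with zero mass flux and non-zero energy flux F =
∫ V₃(|V|²/2 + Q) through the unit square of the plane z = 1 (steady Euler is V ↦ −V symmetric, so F
≠ 0 and F < 0 are the same statement here; a witness feeding #3 must also have ⟨V₃V_h⟩ = 0).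
[difficulty: open-problem] (why it might fail: F ≠ 0 needs two disjoint wall-asymptotic potential
channel systems of different head, separated through infinitely many 4-way branchings by stretched
vortex sheaths with stagnation curves at each junction; no such steady Euler flow is known, 2-D is
provably empty, a degree-0 identity may force F=0.) [arXiv:2301.09603,
doi:10.1090/s0002-9947-1984-0732100-6, doi:10.1512/iumj.1984.33.33011,
doi:10.1512/iumj.1984.33.33021, arXiv:1510.03378, doi:10.1017/s0022112082001311, decl
Literature.Barriers.AnomalousDissipation.DeRosaDrivasInversi2024_thm12_bounded]
#3 ViscousContinuation (crux, RESTATED rev 2) — if a half-space hierarchy exists then a VISCOUS WALL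
PROFILE exists: a bounded smooth mirror-symmetric (z ↦ −z) force-free steady Navier–Stokes flow W at
ν = 1 on all of ℝ³ with bounded pressure P, divergence free, whose dyadic blow-downs (W, P)(2^m X)
converge uniformly on the fundamental band to a half-space hierarchy (V, Q) with non-zero flux — no
periodicity clause on W (verbatim decl ViscousWallProfile). [deps: HalfSpaceHierarchy] [difficulty:
XL] (why it might fail: needs a NONTRIVIAL bounded force-free steady NS flow on ℝ³ fed from infinity
— the steady case of the KNSS bounded Liouville conjecture kills it; W admits no exact horizontal
period (analytic rigidity, landed), and the level map at V may have no exponential dichotomy with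
viscosity the only wall-ward unstable direction.) [arXiv:0709.3599, doi:10.2307/2372830,
doi:10.1007/bf00247697, doi:10.1016/0022-0396(82)90058-4, doi:10.1007/s00023-016-0519-0,
doi:10.12942/lrr-2007-5, decl
Summit.AnomalousDissipation.AnomalousDissipation.Theorems.WallProfileExists_false_of_SteadyNSRealAnalytic]
#4 DyadicRealisation (crux, RESTATED rev 2: antecedent = the repaired block) — if a viscous wall
profile exists then the steady zeroth law holds: ONE smooth divergence-free mean-zero steady force f
on T³, viscosities ν_j → 0 and steady classical states with ∫|u_j|² ≤ E and ν_j‖∇u_j‖² ≥ ε > 0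
(verbatim the shared decl CoherentStates.SteadyZerothLaw, stmt-0219); intended along ν_m = 2^(-m):
in inner units the box state is a 2^m-periodic force-free approximant U_m of the aperiodic W below
height ~2^(m−2), u_m(x) = U_m(x/ν_m), matched through V to an outer conveyor flow driven by f, the
level-0 vorticity injector, no closed streamlines. [deps: ViscousContinuation] [difficulty: XL] (why
it might fail: W is aperiodic, so the box state is an m-dependent 2^m-periodic approximant U_m of W:
needs uniform-in-m invertibility (modulo symmetries) of the linearised steady NS operator at W on
growing slabs AND an outer pump reproducing V's top-band trace with ONE smooth f; the O(ν^(1/2))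
sheath mismatch may beat the resolvent — the refuter rates this stmt-0219-hard.) [arXiv:2207.06301,
arXiv:2311.04182, doi:10.1016/0022-0396(82)90058-4, decl
Literature.Barriers.AnomalousDissipation.AlexakisDoering2006_energyDissipationBound]
#9 ViscousWallProfile (support, NEW rev 2) — the viscous wall profile exists (the conclusion of #3
and the premise of #4 as a free-standing statement, for direct attack by disprovers and for the hold
mechanism): (W, P) bounded smooth on ℝ³, mirror-symmetric, divergence free, force-free steady
Navier–Stokes at ν = 1, (W, P)(2^m·) → (V, Q) uniformly on the band for a half-space hierarchy (V,
Q, C, F) as in #2; no periodicity of W. [difficulty: open-problem] [arXiv:0709.3599,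
doi:10.1007/s00023-016-0519-0]
#9 WallProfileExists (support, rev-1 object, HELD) — false modulo
Literature.Uncategorized.SteadyNSRealAnalytic by the landed negative lemma
WallProfileExists_false_of_SteadyNSRealAnalytic (p141739); kept in the route untouched so that the
lemma keeps compiling and the statement stays indexed as the settled negative edge; it is no
hypothesis of `closes` and nothing should be built on it.

TWO-LAYER PLAN. Foreseen, NOT filed (each after the named crux is stamped or closes):
HalfSpaceHierarchy ⇐ SheetSkeleton (two-phase potential
counterflow with constant Bernoulli jump in the twisted cell: shape-critical point of channel energy
at fixed phase volume) →
SheathSmoothing (sheets thickened to stretched smooth sheaths); ViscousContinuation ⇐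
LevelMapDichotomy (the lens's
LinearisedStability: exponential dichotomy / spectral enclosure of the linearised level map at V in
a dilation-weighted space —
computational once V is known, finite-rank truncation over K levels + self-similar tail) →
TruncatedProfiles (force-free steady NS on
the slab |Z| ≤ 2^K, 2^K-periodic, mirror, matched to V on the top band) → ProfileLimit (K → ∞:
compactness from the uniform bound,
aperiodic limit W, uniformity of the blow-down from the dichotomy); DyadicRealisation ⇐
InnerApproximant (the truncated profiles U_m ARE
the inner box states: ‖U_m − W‖ → 0 below height 2^(m−2), from the same dichotomy) → QuasiLadder
(outer pump + matching through V,
residual ≤ Cν^K₁, polynomial resolvent bound ν^(-K₀), 2K₀+2 ≤ K₁) → NewtonClosing. The rev-1 birth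
skeletons (bc/*_birth.lean of the
opener) type the last two chains against the rev-1 block and must be re-cut against
ViscousWallProfile.

KILL CRITERIA. ¬HalfSpaceHierarchy (e.g. a degree-0 flux identity on the twisted band, or a 3-D
analogue of the 2-D stream-function contraction)
closes the route `refuted:HalfSpaceHierarchy` — there is no other profile. A Liouville theorem for
bounded force-free steady
Navier–Stokes flows on ℝ³ with a mirror plane and bounded pressure (the steady case of the
bounded-ancient-solution conjecture of
Koch–Nadirashvili–Seregin–Šverák, arXiv:0709.3599) — or merely for those converging uniformly, as z
→ +∞, to a bounded steady Euler
flow with non-zero energy flux — refutes ViscousWallProfile and with it ViscousContinuation's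
mechanism: close
`refuted:ViscousContinuation`. (Exact horizontal periodicity of W is ALREADY refuted — rev 1,
analytic rigidity — and is no longer part
of the line; a refutation that re-imposes it is not a kill.) A proof of Neg.SteadyNeg /
CoherentStates.SteadyNeg (0222) kills #4's
conclusion for every f: close. FrozenK41.FrozenStandingCascade (14305) refuted by a "strong L²
limits of bounded steady families are
work-free" theorem also kills #4 (our family converges strongly). SteadyZerothLaw (0219) proved
elsewhere moots #4 but not #2/#3 (which
then migrate to a DRI-sharpness Euler-side statement).

NOT DECOMPOSED YET. The pump (choice of f: vorticity injector with curl f on the level-0 sheath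
stream-tube, return flow potential, no closed streamlines
so that the linearised steady problem is transport + pressure, not Prandtl–Batchelor); the function
spaces of the level map and its
dichotomy (LinearisedStability proper — only after a numerical V exists); the horizontal structure
of W (limit-periodic per height
slab: 2^j is an almost-period of W only below height ~2^j, the cap being modulated by every level
above it; rate W − V = O(Z^(-1/2));
blow-down convergence filed UNIFORM in the horizontal variables — locally uniform would be the
fallback restatement if uniformity is
what fails); the 4-fold horizontal symmetry making ⟨V₃V_h⟩ = 0, now NEEDED by #3 (bounded W) and to
be imposed on #2's witness when #3
is attacked; constants of the Newton step. Two layers only.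

CHEAPEST FALSIFIER. A degree-0 identity for steady Euler on the band 1 ≤ z ≤ 2 with the twisted
matching (top trace = x-dilated bottom trace) that
forces the energy flux F to vanish. Tried at C0 by the opener: the vertical virial identity gives
∫_band(V₃²+Q) = M (no constraint);
the conserved fluxes of degree −1 (⟨HΩ₃⟩, ⟨V₃ω_h − ω₃V_h⟩) vanish consistently; F and M (degree 0)
stay free — no kill found. The 2-D
version IS killed (Ψ_D ⊆ (Ψ_D − c₀)/2 ⇒ zero descending flux), which makes #2 genuinely 3-D. For the
viscous side (rev 2) the cheapest
kill is a flux identity for bounded mirror-symmetric entire steady NS flows forcing the asymptotic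
energy flux J(+∞) = F to vanish
WITHOUT periodicity: the periodic case is three lines (above); the aperiodic case must fail because
the flux at height Z is carried at
horizontal scale ~Z with ∇W → 0 — a refuter should try exactly this first. Next cheapest:
shape-Newton numerics for the SheetSkeleton
in the twisted cell (two Neumann Laplace solves per step on a 64³ cell; kit, ~10³ core-h).

NUMBERS. (h, D) = (0, 2): Frisch–Parisi h = 1/3 − (3 − D)/3; measured D ≈ 2.87 (Meneveau–Sreenivasan
doi:10.1017/s0022112091001830, quoted
by DRI p.6) — the witness is more intermittent than turbulence, by design. Dissipation of the family
= 2|F|·(wall area) + O(ν);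
energy ≤ sup|W|²; cap Reynolds number = sup|W| (cell size ~1 at the cap in units where ν = 1); depth
K = log₂(1/ν) levels; sheath
mismatch at level j: O(2^(-j/2)) (diffusive); dissipation density of W at height Z ~ Z^(-2).
Existing steady numerics
(Cruxes/SteadyStatesLoudBounded/NumericsJ006377.md: f_GP primary branch D ≈ 0.94–1.5, E ≈ 5 down to
ν = 0.028) are branch-following
and do not probe this geometry.

DEFINITION REQUESTS. None now (all clauses inlined over Mathlib: ContDiffOn/fderiv/gradient/set
integrals on EuclideanSpace ℝ (Fin 3)). Foreseen if #2 is
staffed: `IsDyadicHierarchy V Q C F` and `IsViscousWallProfile W P C' V Q` under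
Summits/AnomalousDissipation/AnomalousDissipation/Theorems
(the inlined clause blocks of #2 and of ViscousWallProfile, verbatim), and a cite fact for De
Rosa–Drivas–Inversi sharpness discussion
(arXiv:2301.09603 p.5).

Novelty: Searches (2026-08-17; local searchd down, OpenAlex 429 — recorded): lit galaxy search "discretely
self-similar" --star all (25 rows:
Choptuik critical collapse, Bradshaw–Tsai DSS NS abstracts; nothing steady/wall); lit galaxy search
"Jets with two fluids" --star all
(3); lit search --source crossref ×8 (ACF two-phase 1984, jets with two fluids I/II, Bradshaw–Tsai
2016, Kohn–Müller 1992,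
Perry–Chong 1982, Hall 2018 VWI arrays, Kirchgässner 1982, Gundlach–Martín-García 2007,
Meneveau–Sreenivasan 1991); lit search --source
s2 "self-similar steady Euler energy flux dissipation hypersurface" (9, none relevant); lit read
arxiv:2301.09603 pp.5–7 (sharpness:
only {T}×T³ and compressible shocks); tree: 48 Theses headers, negatives, corpses,
Cruxes/SteadyStatesLoudBounded census/numerics.
Nearest prior art found: FrozenK41 #5a FrozenStandingCascade (stmt-14305: strong-L² standing cascade
as a TARGET, K41 corner) and
BoussinesqOctaves (geometric ladder by INDUCTION, periodic K41 octaves); literature: De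
Rosa–Drivas–Inversi arXiv:2301.09603 (the bound
we saturate), Shvydkoy arXiv:1510.03378 (CONTINUOUSLY homogeneous steady Euler about a point),
Bradshaw–Tsai
doi:10.1007/s00023-016-0519-0 (DSS NS, forward Cauchy), Alt–Caffarelli–Friedman
doi:10.1512/iumj.1984.33.33011 (two-fluid jets),
Perry–Chong doi:10.1017/s0022112082001311 (attached-eddy hierarchy, statistical), Hall
doi:10.1017/jfm.2018.425 (VWI arrays, asymptotic).
Delta: an EXACTLY dilation-invariant steady Euler hierarchy attached  [refs: 10.1007/s00023-016-0519-0, 10.1512/iumj.1984.33.33011, 10.1017/s0022112082001311, 10.1017/jfm.2018.425, 2301.09603, 1510.03378, arxiv:2301.09603, doi:10.1007/s00023-016-0519-0, doi:10.1512/iumj.1984.33.33011, doi:10.1017/s0022112082001311, doi:10.1017/jfm.2018.425]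

Barriers (technique_class: discrete-self-similarity, steady-euler-hierarchy, gluing): - technique_class: discrete-self-similarity, steady-euler-hierarchy, gluing
- Literature.Barriers.AnomalousDissipation.DeRosaDrivasInversi2024_thm12_bounded: met at EQUALITY —
the limit dissipation is 2|F|·H³⌊(ℝ×Σ), absolutely continuous w.r.t. H^3 space–time (d = 3); the
barrier kills points/curves/blow-up instants as carriers (it killed g1's point sink), not a plane.
- Literature.Barriers.AnomalousDissipation.DeRosaInversi2024_thm12: evaded — the hierarchy has |∇V|
~ 1/z (log-divergent BV mass; sheet idealisation has infinite total sheet area), so the limit field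
is not BV∩L^∞ near Σ; a BV witness would indeed be work-free.
- Literature.Barriers.AnomalousDissipation.AlexakisDoering2006_energyDissipationBound: evaded — the
object does not exist in 2-D (stream-function contraction, NOTES L3) and the mechanism
(perimeter-doubling stretching of sheaths; vorticity ~2^k regenerated by stretching in the cap) is
3-D only; steady 2-D is quiet (ε ≲ ν^(1/3)).
- Literature.Barriers.AnomalousDissipation.Marchioro1986_globalAttraction: evaded — the pump force
is broadband (a localized vorticity injector), not gravest-shell; Tran–Shepherd single-shell pincers
do not apply.
- Literature.Barriers.AnomalousDissipation.Cheskidov2023_thm13_not_forceRobustNoAnomaly: not in the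
class — this is a construction of exact steady states, not a force-robust estimate.
- Literature.Barriers.AnomalousDissipation.BrueDeLellis2023_noAnomaly_beforeEulerSingularity: evaded
— the data u_m(0) = u_m converge str

History (route lifecycle, newest last):
- 2026-08-17T05:03:21Z · rev 2: restated ViscousContinuation (stmt-AnomalousDissipation-18629), DyadicRealisation (stmt-AnomalousDissipation-18630) — repair (route-repair, refuted-misstated by refuter rattack-18630; negative lemma WallProfileExists_false_of_SteadyNSRealAnalytic p141739, fact SteadyNSRealAnaly (planner-rrefute-AnomalousDissipation-DyadicWal-db8c8517-0)
- 2026-08-24T13:48:08Z · DORMANT — reconciler: no traction for 6.8 d (last activity item-evidence-added at 2026-08-17T17:51:17Z); parked, not closed — `ledger route dormant route-AnomalousDissipa (operator:999:2209125)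

sub-problem: AnomalousDissipation · status: dormant · opened planner-plan-lens3-AnomalousDissipation-profile-g2-0 2026-08-17T02:52:13Z · rev 2 · ledger route-AnomalousDissipation-DyadicWallCascade
GENERATED by the gate from the ledger (D-0016/17). Provers cite these decls: `theorem foo : Summit.AnomalousDissipation.AnomalousDissipation.Theses.DyadicWallCascade.<Decl> := …` in Summits/AnomalousDissipation/AnomalousDissipation/Theorems/<Name>.lean.
-/

namespace Summit.AnomalousDissipation.AnomalousDissipation.Theses.DyadicWallCascade

open scoped BigOperators Topology Manifold Classical MeasureTheory ProbabilityTheory Matrix InnerProductSpace ComplexConjugate ContinuousMap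
open Filter Set Function TopologicalSpace MeasureTheory

attribute [summit_statement] _root_.AnomalousDissipation

open Literature.Turb

/-- item stmt-AnomalousDissipation-18627 · crux · rank 2 · open · by planner
why it might fail: F ≠ 0 needs two disjoint wall-asymptotic potential channel systems of different head, separated through infinitely many 4-way branchings by stretched vortex sheaths with stagnation curves at each junction; no such steady Euler flow is known, 2-D is provably empty, a degree-0 identity may force F=0.
sources: arXiv:2301.09603, doi:10.1090/s0002-9947-1984-0732100-6, doi:10.1512/iumj.1984.33.33011, doi:10.1512/iumj.1984.33.33021, arXiv:1510.03378, doi:10.1017/s0022112082001311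
[crux] there is a bounded steady Euler flow (V, Q) on the open upper half-space, smooth there,
divergence free, 1-periodic in x and y on the band 1 ≤ z ≤ 2, invariant under X ↦ 2X (V and Q of
degree 0), with zero mass flux and non-zero energy flux F = ∫ V₃(|V|²/2 + Q) through the unit square
of the plane z = 1. [difficulty: open-problem] -/
@[route_item "route-AnomalousDissipation-DyadicWallCascade", crux]
def HalfSpaceHierarchy : Prop :=
  ∃ (V : EuclideanSpace ℝ (Fin 3) → EuclideanSpace ℝ (Fin 3)) (Q : EuclideanSpace ℝ (Fin 3) → ℝ) (C F : ℝ), let H : Set (EuclideanSpace ℝ (Fin 3)) := {X | 0 < X 2}; let e : Fin 3 → EuclideanSpace ℝ (Fin 3) := fun i => EuclideanSpace.single i (1 : ℝ); let pt : ℝ × ℝ → EuclideanSpace ℝ (Fin 3) := fun q => !₂[q.1, q.2, (1 : ℝ)]; ContDiffOn ℝ ((⊤ : ℕ∞) : WithTop ℕ∞) V H ∧ ContDiffOn ℝ ((⊤ : ℕ∞) : WithTop ℕ∞) Q H ∧ (∀ X ∈ H, ‖V X‖ ≤ C ∧ |Q X| ≤ C) ∧ (∀ X ∈ H, ∑ i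 : Fin 3, (fderiv ℝ V X (e i)) i = 0) ∧ (∀ X ∈ H, (fderiv ℝ V X) (V X) + gradient Q X = 0) ∧ (∀ X ∈ H, V ((2 : ℝ) • X) = V X ∧ Q ((2 : ℝ) • X) = Q X) ∧ (∀ X : EuclideanSpace ℝ (Fin 3), 1 ≤ X 2 → X 2 ≤ 2 → V (X + e 0) = V X ∧ V (X + e 1) = V X ∧ Q (X + e 0) = Q X ∧ Q (X + e 1) = Q X) ∧ (∫ q in Set.Icc (0 : ℝ) 1 ×ˢ Set.Icc (0 : ℝ) 1, (V (pt q)) 2 = 0) ∧ F ≠ 0 ∧ (∫ q in Set.Icc (0 : ℝ) 1 ×ˢ Set.Icc (0 : ℝ) 1, (V (pt q)) 2 * (‖V (pt q)‖ ^ 2 / 2 + Q (pt q)) = F)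

-- earlier ViscousContinuation (stmt-AnomalousDissipation-18629, replaced 2026-08-17T05:03:21Z -> stmt-AnomalousDissipation-17917): retired by None — HalfSpaceHierarchy → (∃ (W : EuclideanSpace ℝ (Fin 3) → EuclideanSpace ℝ (Fin 3)) (P : EuclideanSpace ℝ (Fin 3) → ℝ) (V : EuclideanSpace ℝ (Fin 3) → EuclideanSpace ℝ (Fin 3)) (Q : EuclideanSpace ℝ (Fin 3) → ℝ) (C F C' : ℝ), let H : Set (EuclideanSpace ℝ
/-- item stmt-AnomalousDissipation-17917 · crux · rank 3 · open · by planner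
why it might fail: needs a NONTRIVIAL bounded force-free steady NS flow on ℝ³ (mirror plane, bounded pressure) fed from infinity — the steady case of the KNSS bounded Liouville conjecture kills it; W admits no exact horizontal period (analytic rigidity, landed); the level map at V may lack an exponential dichotomy.
sources: arXiv:0709.3599, doi:10.2307/2372830, doi:10.1007/bf00247697, doi:10.1016/0022-0396(82)90058-4, doi:10.1007/s00023-016-0519-0, doi:10.12942/lrr-2007-5
[crux] if a half-space hierarchy exists then a VISCOUS WALL PROFILE exists: a bounded smooth
mirror-symmetric (z ↦ −z) force-free steady Navier–Stokes flow W at ν = 1 on all of ℝ³ with bounded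
pressure P, divergence free, whose dyadic blow-downs (W, P)(2^m X) converge uniformly on the
fundamental band 1 ≤ z ≤ 2 to a half-space hierarchy (V, Q) with non-zero energy flux — equivalently
(W, P) → (V, Q) uniformly as z → +∞, V being dilation invariant (verbatim the free-standing decl
ViscousWallProfile). RESTATED rev 2 (route-repair after refuter rattack-18630): NO exact horizontal
period of W anywhere — rev 1 asked period 1 on |z| ≤ 1 and 2^j on the dyadic bands, impossible for a
real-analytic entire flow (negative lemma WallProfileExists_false_of_SteadyNSRealAnalytic: the
period spreads to all heights and the blow-down has F = 0); the dyadic horizontal structure is V's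
and W inherits it only asymptotically. Forced normalisations: F < 0, ⟨V₃V_h⟩ = 0, dissipation 2|F|
per unit wall area. [deps: HalfSpaceHierarchy] [difficulty: XL] -/
@[route_item "route-AnomalousDissipation-DyadicWallCascade", crux]
def ViscousContinuation : Prop :=
  HalfSpaceHierarchy → (∃ (W : EuclideanSpace ℝ (Fin 3) → EuclideanSpace ℝ (Fin 3)) (P : EuclideanSpace ℝ (Fin 3) → ℝ) (V : EuclideanSpace ℝ (Fin 3) → EuclideanSpace ℝ (Fin 3)) (Q : EuclideanSpace ℝ (Fin 3) → ℝ) (C F C' : ℝ), let H : Set (EuclideanSpace ℝ (Fin 3)) := {X | 0 < X 2}; let e : Fin 3 → EuclideanSpace ℝ (Fin 3) := fun i => EuclideanSpace.single i (1 : ℝ); let pt : ℝ × ℝ → EuclideanSpace ℝ (Fin 3) := fun q => !₂[q.1, q.2, (1 : ℝ)]; let σ : EuclideanSpace ℝ (Fin 3) → EuclideanSpace ℝ (Fin 3) := fun X => X - (2 * X 2) • e 2; (ContDiffOn ℝ ((⊤ : ℕ∞) : WithTop ℕ∞) V H ∧ ContDiffOn ℝ ((⊤ : ℕ∞) : WithTop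 ℕ∞) Q H ∧ (∀ X ∈ H, ‖V X‖ ≤ C ∧ |Q X| ≤ C) ∧ (∀ X ∈ H, ∑ i : Fin 3, (fderiv ℝ V X (e i)) i = 0) ∧ (∀ X ∈ H, (fderiv ℝ V X) (V X) + gradient Q X = 0) ∧ (∀ X ∈ H, V ((2 : ℝ) • X) = V X ∧ Q ((2 : ℝ) • X) = Q X) ∧ (∀ X : EuclideanSpace ℝ (Fin 3), 1 ≤ X 2 → X 2 ≤ 2 → V (X + e 0) = V X ∧ V (X + e 1) = V X ∧ Q (X + e 0) = Q X ∧ Q (X + e 1) = Q X) ∧ (∫ q in Set.Icc (0 : ℝ) 1 ×ˢ Set.Icc (0 : ℝ) 1, (V (pt q)) 2 = 0) ∧ F ≠ 0 ∧ (∫ q in Set.Icc (0 : ℝ) 1 ×ˢ Set.Icc (0 : ℝ) 1, (V (pt q)) 2 * (‖V (pt q)‖ ^ 2 / 2 + Q (pt q)) = F)) ∧ ContDiff ℝ ((⊤ : ℕ∞) : WithTop ℕ∞) W ∧ ContDiff ℝ ((⊤ : ℕ∞) : WithTop ℕ∞) P ∧ (∀ X, ‖W X‖ ≤ C' ∧ |P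 X| ≤ C') ∧ (∀ X, W (σ X) = σ (W X) ∧ P (σ X) = P X) ∧ (∀ X, ∑ i : Fin 3, (fderiv ℝ W X (e i)) i = 0) ∧ (∀ X, (fderiv ℝ W X) (W X) + gradient P X = ∑ i : Fin 3, fderiv ℝ (fun Y => fderiv ℝ W Y (e i)) X (e i)) ∧ (∀ ε : ℝ, 0 < ε → ∃ M : ℕ, ∀ m : ℕ, M ≤ m → ∀ X : EuclideanSpace ℝ (Fin 3), 1 ≤ X 2 → X 2 ≤ 2 → ‖W ((2 : ℝ) ^ m • X) - V X‖ ≤ ε ∧ |P ((2 : ℝ) ^ m • X) - Q X| ≤ ε))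

-- earlier DyadicRealisation (stmt-AnomalousDissipation-18630, replaced 2026-08-17T05:03:21Z -> stmt-AnomalousDissipation-17918): retired by None — (∃ (W : EuclideanSpace ℝ (Fin 3) → EuclideanSpace ℝ (Fin 3)) (P : EuclideanSpace ℝ (Fin 3) → ℝ) (V : EuclideanSpace ℝ (Fin 3) → EuclideanSpace ℝ (Fin 3)) (Q : EuclideanSpace ℝ (Fin 3) → ℝ) (C F C' : ℝ), let H : Set (EuclideanSpace ℝ (Fin 3)) := {X | 0 < X
/-- item stmt-AnomalousDissipation-17918 · crux · rank 4 · open · by planner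
why it might fail: W is aperiodic, so the box state is an m-dependent 2^m-periodic approximant U_m of W: needs uniform-in-m invertibility of the linearised steady NS operator at W on growing slabs AND one smooth outer pump matching V's top-band trace; the O(ν^(1/2)) sheath mismatch may beat the resolvent.
sources: arXiv:2207.06301, arXiv:2311.04182, doi:10.1016/0022-0396(82)90058-4, decl Literature.Barriers.AnomalousDissipation.AlexakisDoering2006_energyDissipationBound
[crux] if a viscous wall profile exists (antecedent = decl ViscousWallProfile verbatim: bounded
smooth mirror-symmetric force-free steady NS flow (W, P) on ℝ³ at ν = 1 blowing down to a half-space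
hierarchy (V, Q) with F ≠ 0; no periodicity of W) then the steady zeroth law holds: ONE smooth
divergence-free mean-zero steady force f on T³, viscosities ν_j → 0 and steady classical states with
∫|u_j|² ≤ E and ν_j‖∇u_j‖² ≥ ε > 0 (verbatim the shared decl CoherentStates.SteadyZerothLaw,
stmt-0219); intended along ν_m = 2^(-m): in inner units the box state is a 2^m-periodic force-free
approximant U_m of the aperiodic W below height ~2^(m−2), u_m(x) = U_m(x/ν_m) ≈ W(x/ν_m), matched
through V to an outer conveyor flow driven by f = the level-0 vorticity injector, no closed
streamlines. RESTATED rev 2: the rev-1 antecedent (WallProfileExists) is unsatisfiable modulo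
SteadyNSRealAnalytic, which made the rev-1 item vacuously true. [deps: ViscousContinuation]
[difficulty: XL] -/
@[route_item "route-AnomalousDissipation-DyadicWallCascade", crux]
def DyadicRealisation : Prop :=
  (∃ (W : EuclideanSpace ℝ (Fin 3) → EuclideanSpace ℝ (Fin 3)) (P : EuclideanSpace ℝ (Fin 3) → ℝ) (V : EuclideanSpace ℝ (Fin 3) → EuclideanSpace ℝ (Fin 3)) (Q : EuclideanSpace ℝ (Fin 3) → ℝ) (C F C' : ℝ), let H : Set (EuclideanSpace ℝ (Fin 3)) := {X | 0 < X 2}; let e : Fin 3 → EuclideanSpace ℝ (Fin 3) := fun i => EuclideanSpace.single i (1 : ℝ); let pt : ℝ × ℝ → EuclideanSpace ℝ (Fin 3) := fun q => !₂[q.1, q.2, (1 : ℝ)]; let σ : EuclideanSpace ℝ (Fin 3) → EuclideanSpace ℝ (Fin 3) := fun X => X - (2 * X 2) • e 2; (ContDiffOn ℝ ((⊤ : ℕ∞) : WithTop ℕ∞) V H ∧ ContDiffOn ℝ ((⊤ : ℕ∞) : WithTop ℕ∞) Q H ∧ (∀ X ∈ H, ‖V X‖ ≤ C ∧ |Q X|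 ≤ C) ∧ (∀ X ∈ H, ∑ i : Fin 3, (fderiv ℝ V X (e i)) i = 0) ∧ (∀ X ∈ H, (fderiv ℝ V X) (V X) + gradient Q X = 0) ∧ (∀ X ∈ H, V ((2 : ℝ) • X) = V X ∧ Q ((2 : ℝ) • X) = Q X) ∧ (∀ X : EuclideanSpace ℝ (Fin 3), 1 ≤ X 2 → X 2 ≤ 2 → V (X + e 0) = V X ∧ V (X + e 1) = V X ∧ Q (X + e 0) = Q X ∧ Q (X + e 1) = Q X) ∧ (∫ q in Set.Icc (0 : ℝ) 1 ×ˢ Set.Icc (0 : ℝ) 1, (V (pt q)) 2 = 0) ∧ F ≠ 0 ∧ (∫ q in Set.Icc (0 : ℝ) 1 ×ˢ Set.Icc (0 : ℝ) 1, (V (pt q)) 2 * (‖V (pt q)‖ ^ 2 / 2 + Q (pt q)) = F)) ∧ ContDiff ℝ ((⊤ : ℕ∞) : WithTop ℕ∞) W ∧ ContDiff ℝ ((⊤ : ℕ∞) : WithTop ℕ∞) P ∧ (∀ X, ‖W X‖ ≤ C' ∧ |P X| ≤ C') ∧ (∀ X, W (σ X) = σ (W X) ∧ P (σ X) = P X)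 ∧ (∀ X, ∑ i : Fin 3, (fderiv ℝ W X (e i)) i = 0) ∧ (∀ X, (fderiv ℝ W X) (W X) + gradient P X = ∑ i : Fin 3, fderiv ℝ (fun Y => fderiv ℝ W Y (e i)) X (e i)) ∧ (∀ ε : ℝ, 0 < ε → ∃ M : ℕ, ∀ m : ℕ, M ≤ m → ∀ X : EuclideanSpace ℝ (Fin 3), 1 ≤ X 2 → X 2 ≤ 2 → ‖W ((2 : ℝ) ^ m • X) - V X‖ ≤ ε ∧ |P ((2 : ℝ) ^ m • X) - Q X| ≤ ε)) → ∃ f : UnitAddTorus (Fin 3) → EuclideanSpace ℝ (Fin 3), Literature.Analysis.FunctionSpaces.Torus.IsSmooth f ∧ Literature.Analysis.FunctionSpaces.Torus.IsDivFree f ∧ Literature.Analysis.FunctionSpaces.Torus.HasZeroMean f ∧ ∃ (ν : ℕ → ℝ) (u : ℕ → UnitAddTorus (Fin 3) → EuclideanSpace ℝ (Fin 3)) (p : ℕ → UnitAddTorus (Fin 3) → ℝ), (∀ j, 0 < ν j) ∧ Filter.Tendsto ν Filter.atTop (nhds 0) ∧ (∀ j, Literature.Analysis.FunctionSpaces.Torus.IsClassicalNSSolutionOn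 Set.univ (ν j) (fun _ => f) (fun _ => u j) (fun _ => p j)) ∧ (∃ E : ℝ, ∀ j, MeasureTheory.integral MeasureTheory.volume (fun x => ‖u j x‖ ^ 2) ≤ E) ∧ ∃ ε : ℝ, 0 < ε ∧ ∀ j, ε ≤ ν j * Literature.Analysis.FunctionSpaces.Torus.gradNormSq (u j)

/-- item stmt-AnomalousDissipation-17919 · support · rank 9 · open · by planner
sources: arXiv:0709.3599, doi:10.1007/s00023-016-0519-0, doi:10.2307/2372830
[support] the viscous wall profile exists — the conclusion of #3 (ViscousContinuation) and the
premise of #4 (DyadicRealisation) as a free-standing statement, for direct attack: (W, P) smooth and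
bounded on ℝ³, mirror-symmetric (z ↦ −z), divergence free, force-free steady Navier–Stokes at ν = 1,
with (W, P)(2^m·) → (V, Q) uniformly on the band 1 ≤ z ≤ 2 for a half-space hierarchy (V, Q, C, F)
exactly as in #2 (HalfSpaceHierarchy); NO periodicity clause on W (rev 2; replaces the rev-1 support
WallProfileExists, which is false modulo SteadyNSRealAnalytic and stays in the route HELD as the
settled negative edge). Consequences a disprover may use: F < 0, zero Reynolds stress ⟨V₃V_h⟩ = 0 of
the blow-down, dissipation 2|F| per unit wall area, ∫⟨|∇W|²⟩dZ < ∞. Kill = a Liouville theorem for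
bounded mirror-symmetric entire steady NS flows (steady KNSS class). [difficulty: open-problem] -/
@[route_item "route-AnomalousDissipation-DyadicWallCascade"]
def ViscousWallProfile : Prop :=
  ∃ (W : EuclideanSpace ℝ (Fin 3) → EuclideanSpace ℝ (Fin 3)) (P : EuclideanSpace ℝ (Fin 3) → ℝ) (V : EuclideanSpace ℝ (Fin 3) → EuclideanSpace ℝ (Fin 3)) (Q : EuclideanSpace ℝ (Fin 3) → ℝ) (C F C' : ℝ), let H : Set (EuclideanSpace ℝ (Fin 3)) := {X | 0 < X 2}; let e : Fin 3 → EuclideanSpace ℝ (Fin 3) := fun i => EuclideanSpace.single i (1 : ℝ); let pt : ℝ × ℝ → EuclideanSpace ℝ (Fin 3) := fun q => !₂[q.1, q.2, (1 : ℝ)]; let σ : EuclideanSpace ℝ (Fin 3) → EuclideanSpace ℝ (Fin 3) := fun X => X - (2 * X 2) • e 2; (ContDiffOn ℝ ((⊤ : ℕ∞) : WithTop ℕ∞) V H ∧ ContDiffOn ℝ ((⊤ : ℕ∞) : WithTop ℕ∞) Q H ∧ (∀ X ∈ H, ‖V X‖ ≤ C ∧ |Q X| ≤ C) ∧ (∀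 X ∈ H, ∑ i : Fin 3, (fderiv ℝ V X (e i)) i = 0) ∧ (∀ X ∈ H, (fderiv ℝ V X) (V X) + gradient Q X = 0) ∧ (∀ X ∈ H, V ((2 : ℝ) • X) = V X ∧ Q ((2 : ℝ) • X) = Q X) ∧ (∀ X : EuclideanSpace ℝ (Fin 3), 1 ≤ X 2 → X 2 ≤ 2 → V (X + e 0) = V X ∧ V (X + e 1) = V X ∧ Q (X + e 0) = Q X ∧ Q (X + e 1) = Q X) ∧ (∫ q in Set.Icc (0 : ℝ) 1 ×ˢ Set.Icc (0 : ℝ) 1, (V (pt q)) 2 = 0) ∧ F ≠ 0 ∧ (∫ q in Set.Icc (0 : ℝ) 1 ×ˢ Set.Icc (0 : ℝ) 1, (V (pt q)) 2 * (‖V (pt q)‖ ^ 2 / 2 + Q (pt q)) = F)) ∧ ContDiff ℝ ((⊤ : ℕ∞) : WithTop ℕ∞) W ∧ ContDiff ℝ ((⊤ : ℕ∞) : WithTop ℕ∞) P ∧ (∀ X, ‖W X‖ ≤ C' ∧ |P X| ≤ C') ∧ (∀ X, W (σ X) = σ (W X) ∧ P (σ X) = P X) ∧ (∀ X, ∑ i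 : Fin 3, (fderiv ℝ W X (e i)) i = 0) ∧ (∀ X, (fderiv ℝ W X) (W X) + gradient P X = ∑ i : Fin 3, fderiv ℝ (fun Y => fderiv ℝ W Y (e i)) X (e i)) ∧ (∀ ε : ℝ, 0 < ε → ∃ M : ℕ, ∀ m : ℕ, M ≤ m → ∀ X : EuclideanSpace ℝ (Fin 3), 1 ≤ X 2 → X 2 ≤ 2 → ‖W ((2 : ℝ) ^ m • X) - V X‖ ≤ ε ∧ |P ((2 : ℝ) ^ m • X) - Q X| ≤ ε)

/-- item stmt-AnomalousDissipation-18628 · support · rank 9 · open · by planner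
sources: arXiv:0709.3599, doi:10.1007/s00023-016-0519-0
[support] the viscous wall profile exists (the conclusion of #3 and the premise of #4 as a
free-standing statement): a pair (W, P) and a hierarchy (V, Q) as in #2 with W bounded, smooth,
mirror-symmetric, divergence free, steady Navier–Stokes at ν = 1 without force on ℝ³, dyadically
band-periodic, blowing down to V. [difficulty: open-problem] -/
@[route_item "route-AnomalousDissipation-DyadicWallCascade"]
def WallProfileExists : Prop :=
  ∃ (W : EuclideanSpace ℝ (Fin 3) → EuclideanSpace ℝ (Fin 3)) (P : EuclideanSpace ℝ (Fin 3) → ℝ) (V : EuclideanSpace ℝ (Fin 3) → EuclideanSpace ℝ (Fin 3)) (Q : EuclideanSpace ℝ (Fin 3) → ℝ) (C F C' : ℝ), let H : Set (EuclideanSpace ℝ (Fin 3)) := {X | 0 < X 2}; let e : Fin 3 → EuclideanSpace ℝ (Fin 3) := fun i => EuclideanSpace.single i (1 : ℝ); let pt : ℝ × ℝ → EuclideanSpace ℝ (Fin 3) := fun q => !₂[q.1, q.2, (1 : ℝ)]; let σ : EuclideanSpace ℝ (Fin 3) → EuclideanSpace ℝ (Fin 3) := fun X => X - (2 * X 2)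 • e 2; (ContDiffOn ℝ ((⊤ : ℕ∞) : WithTop ℕ∞) V H ∧ ContDiffOn ℝ ((⊤ : ℕ∞) : WithTop ℕ∞) Q H ∧ (∀ X ∈ H, ‖V X‖ ≤ C ∧ |Q X| ≤ C) ∧ (∀ X ∈ H, ∑ i : Fin 3, (fderiv ℝ V X (e i)) i = 0) ∧ (∀ X ∈ H, (fderiv ℝ V X) (V X) + gradient Q X = 0) ∧ (∀ X ∈ H, V ((2 : ℝ) • X) = V X ∧ Q ((2 : ℝ) • X) = Q X) ∧ (∀ X : EuclideanSpace ℝ (Fin 3), 1 ≤ X 2 → X 2 ≤ 2 → V (X + e 0) = V X ∧ V (X + e 1) = V X ∧ Q (X + e 0) = Q X ∧ Q (X + e 1) = Q X) ∧ (∫ q in Set.Icc (0 : ℝ) 1 ×ˢ Set.Icc (0 : ℝ) 1, (V (pt q)) 2 = 0) ∧ F ≠ 0 ∧ (∫ q in Set.Icc (0 : ℝ) 1 ×ˢ Set.Icc (0 : ℝ) 1, (V (pt q)) 2 * (‖V (pt q)‖ ^ 2 / 2 + Q (pt q)) = F)) ∧ ContDiff ℝ ((⊤ : ℕ∞) : WithTop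 ℕ∞) W ∧ ContDiff ℝ ((⊤ : ℕ∞) : WithTop ℕ∞) P ∧ (∀ X, ‖W X‖ ≤ C') ∧ (∀ X, W (σ X) = σ (W X) ∧ P (σ X) = P X) ∧ (∀ X, ∑ i : Fin 3, (fderiv ℝ W X (e i)) i = 0) ∧ (∀ X, (fderiv ℝ W X) (W X) + gradient P X = ∑ i : Fin 3, fderiv ℝ (fun Y => fderiv ℝ W Y (e i)) X (e i)) ∧ (∀ X : EuclideanSpace ℝ (Fin 3), |X 2| ≤ 1 → W (X + e 0) = W X ∧ W (X + e 1) = W X) ∧ (∀ (j : ℕ) (X : EuclideanSpace ℝ (Fin 3)), (2 : ℝ) ^ j ≤ |X 2| → |X 2| ≤ (2 : ℝ) ^ (j + 1) → W (X + (2 : ℝ) ^ j • e 0) = W X ∧ W (X + (2 : ℝ) ^ j • e 1) = W X) ∧ (∀ ε : ℝ, 0 < ε → ∃ M : ℕ, ∀ m : ℕ, M ≤ m → ∀ X : EuclideanSpace ℝ (Fin 3), 1 ≤ X 2 → X 2 ≤ 2 → ‖W ((2 : ℝ) ^ m • X) - V X‖ ≤ ε)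

/-- item stmt-AnomalousDissipation-18631 · assembly · rank 1 · open · by planner
sources: arXiv:2301.09603, arXiv:2207.06301
[assembly] HalfSpaceHierarchy → ViscousContinuation → DyadicRealisation → AnomalousDissipation. -/
@[route_item "route-AnomalousDissipation-DyadicWallCascade"]
def Assembly : Prop :=
  HalfSpaceHierarchy → ViscousContinuation → DyadicRealisation → _root_.AnomalousDissipation

/-! D-0027 §2.1 — DECIDING THEOREM (planner-authored via `route open/edit --closes-file`; by planner-rrefute-AnomalousDissipation-DyadicWal-db8c8517-0 2026-08-17T05:03:21Z):
its hypotheses are this route's items and its conclusion the sub-problem Statement (glue_lint), and it elaborates with this file. -/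

@[closes "route-AnomalousDissipation-DyadicWallCascade"] theorem closes (h₂ : HalfSpaceHierarchy) (h₃ : ViscousContinuation) (h₄ : DyadicRealisation) :
    _root_.AnomalousDissipation := by
  have hS := Summit.AnomalousDissipation.AnomalousDissipation.Theorems.steadyToSummit_proof
  unfold Summit.AnomalousDissipation.AnomalousDissipation.Theses.SteadyWeakLimit.SteadyToSummit at hS
  exact hS (h₄ (h₃ h₂))

end Summit.AnomalousDissipation.AnomalousDissipation.Theses.DyadicWallCascade
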